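import Mathlib
import HarnessLib
import Summits.ResolutionOfSingularities.ResolutionOfSingularities.Theorems.WildQuotientsWildQuotientResolutionS1aA1Cover
import Summits.ResolutionOfSingularities.ResolutionOfSingularities.Theorems.WildQuotientsWildQuotientResolutionS1aA1Move2Ring

/-!
# S1a — INSTANCE I-2 (a1), ring level, MOVE 2: the σ′-fixed norm cover `((X₀′^{dp}/h)^{d₂}, N₂^{2dd₂})`, `hrad`, and the degree-0 residual sections

[OURS · L1 W4.5c · lead-1 g12; plan-1 R-F15c (I-2 := MT-a1″), X-CERT v1 §3 a1 move 2 «[X₀′]₂: RESIDUAL V(e₂, x₂″, e₁); N(x₂): KILLED (row of x₃)», my F13;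
pattern of ✓`…A1Cover` (move 1)] — NOT statements of the manuscript; counted 0; AI-level work, weaker than expert review. Crux stmt-ResolutionOfSingularities-17941
`CyclicQuotientFourfolds`, line `s1a-logminvertex` v13.

Abstract setting of ✓`…A1Move2Ring`: a ring `P` (meant: the model `k[x_none, x′][1/h]` of the norm chart of move 1) with `τ`, elements `s, X₀, X₁, x₂, x₃`, the rows of
F13, and a unit `η` (meant: `h`) with inverse `ηinv`, both `τ`-fixed; centre `(X₀, x₂)`, weights `(2, 1)`; `dbar = d(2p)` the Veronese degree of move 1 (so `k₂ := dbar`,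
`dbar₂ = d₂ · dbar`). With the NORM `N₂ = ∏_{i : ZMod p} (x₂ + i·s²X₀)`:
* `prod_shift_fixed` (generic: `τ a = a + b`, `τ b = b` ⇒ `τ ∏(a + i b) = ∏(a + i b)` in characteristic `p`), `a1m2_norm_fixed`, `a1m2_norm_mem` (`N₂ ∈ 𝒥′_p`);
* cover: `a1m2_cover_zero_mem/fixed` (`y′₀ = (X₀^{dp}·ηinv)^{d₂} ∈ 𝒥′_{dbar₂}`), `a1m2_cover_one_mem/fixed` (`y′₁ = N₂^{2dd₂} ∈ 𝒥′_{dbar₂}`);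
* ★ `a1m2_hrad` — in `R^w(P; X₀, x₂)`: `Y₀ = X₀T², Y₂ = x₂T ∈ √(y′₀T^{dbar₂}, y′₁T^{dbar₂})` (`Y₀^{dpd₂} = y′₀T^{dbar₂}·η^{d₂}`; `(∏(Y₂ + i s²·s₂Y₀))^{2dd₂} = y′₁T^{dbar₂}`,
  `∏(…) ≡ Y₂^p mod Y₀`);
* degrees (any grading `𝒜` of `P` by `Π j, ZMod (r j)` with `X₀ ∈ 𝒜 (2•θ)`, `x₂ ∈ 𝒜 0`, `X₁ ∈ 𝒜 θ`, `s ∈ 𝒜 (−θ)`, `ηinv ∈ 𝒜 (−(dbar•θ))`): `a1m2_hf`, `a1m2_cover_zero_deg`,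
  `a1m2_norm_deg`, and ★ the RESIDUAL SECTIONS `a1m2_residualSection_b/c` — `((Y₀s₂)^{dbar} ηinv²)^{d₂} / c` and `((X₁Y₂)^{dbar} ηinv)^{d₂} / c` have degree 0 on every
  chart `c = y′T^{dbar₂}` and lie in `𝔞·R_{y′}` for every ideal `𝔞 ∋ Y₀s₂` resp. `∋ X₁Y₂` (✓`a1m2_residual_mem`).
-/

set_option linter.dupNamespace false

noncomputable section

open Literature.AlgebraicGeometry.Resolution
open scoped LaurentPolynomial
open Summit.ResolutionOfSingularities.ResolutionOfSingularities.Theorems.WildQuotientResolution.S1.CoarseChart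
open Summit.ResolutionOfSingularities.ResolutionOfSingularities.Theorems.WildQuotientResolution.S1.BlowupCharts
open Summit.ResolutionOfSingularities.ResolutionOfSingularities.Theorems.WildQuotientResolution.S1.ReesBigrading

namespace Summit.ResolutionOfSingularities.ResolutionOfSingularities.Theorems.WildQuotientResolution.S1.KillCert.A1

/-- **Shifted products are fixed**: if `τ a = a + b` and `τ b = b` in characteristic `p ≠ 1`, then `τ` fixes `∏_{i : ZMod p} (a + i·b)`. [folklore] -/
theorem prod_shift_fixed {R : Type*} [CommRing R] {p : ℕ} [NeZero p] [CharP R p] (hp1 : p ≠ 1) (τ : R ≃+* R) (a b : R) (ha : τ a = a + b) (hb : τ b = b) :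
    τ (∏ i : ZMod p, (a + (i.val : R) * b)) = ∏ i : ZMod p, (a + (i.val : R) * b) := by
  rw [map_prod]
  have hτ : ∀ i : ZMod p, τ (a + (i.val : R) * b) = a + ((i + 1).val : R) * b := by
    intro i
    rw [map_add, map_mul, map_natCast, ha, hb]
    have hval : ((i + 1).val : R) = (i.val : R) + 1 := by
      rw [ZMod.val_add, ZMod.val_one'' hp1, ← CharP.cast_eq_mod R p (i.val + 1), Nat.cast_add, Nat.cast_one]
    rw [hval]; ring
  simp_rw [hτ]
  exact Fintype.prod_equiv (Equiv.addRight 1) _ _ fun i => rfl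

variable {P : Type} [CommRing P] (τ : P ≃+* P) (s X₀ X₁ x₂ x₃ η ηinv : P)
  (hs : τ s = s) (hX₀ : τ X₀ = X₀) (hx₂ : τ x₂ = x₂ + s ^ 2 * X₀) (hηinv : τ ηinv = ηinv) (hηη : η * ηinv = 1)
  {p : ℕ} (d d₂ : ℕ)

/-! ## The norm `N₂` and the cover -/

include hs hX₀ hx₂ in
/-- `τ N₂ = N₂`. -/
theorem a1m2_norm_fixed [NeZero p] [CharP P p] (hp1 : p ≠ 1) :
    τ (∏ i : ZMod p, (x₂ + (i.val : P) * (s ^ 2 * X₀))) = ∏ i : ZMod p, (x₂ + (i.val : P) * (s ^ 2 * X₀)) :=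
  prod_shift_fixed hp1 τ x₂ (s ^ 2 * X₀) hx₂ (by rw [map_mul, map_pow, hs, hX₀])

/-- `N₂ ∈ 𝒥′_p`. -/
theorem a1m2_norm_mem [NeZero p] : (∏ i : ZMod p, (x₂ + (i.val : P) * (s ^ 2 * X₀))) ∈ (weightedFiltration (![X₀, x₂] : Fin 2 → P) ![2, 1]).ideal p := by
  have h1 : ∀ i : ZMod p, x₂ + (i.val : P) * (s ^ 2 * X₀) ∈ (weightedFiltration (![X₀, x₂] : Fin 2 → P) ![2, 1]).ideal 1 := fun i =>
    add_mem (mem_weightedFiltration_ideal (![X₀, x₂] : Fin 2 → P) ![2, 1] 1)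
      (Ideal.mul_mem_left _ _ (Ideal.mul_mem_left _ _ ((weightedFiltration (![X₀, x₂] : Fin 2 → P) ![2, 1]).antitone (by norm_num : 1 ≤ 2)
        (mem_weightedFiltration_ideal (![X₀, x₂] : Fin 2 → P) ![2, 1] 0))))
  have := Ideal.prod_mem_prod (s := (Finset.univ : Finset (ZMod p))) (fun i _ => h1 i)
  rw [Finset.prod_const, Finset.card_univ, ZMod.card] at this
  have hle := Veronese.idealFiltration_pow_le (weightedFiltration (![X₀, x₂] : Fin 2 → P) ![2, 1]) 1 p
  rw [one_mul] at hle
  exact hle this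

/-- **Cover element 0** of move 2: `y′₀ = (X₀^{dp}·ηinv)^{d₂} ∈ 𝒥′_{d₂·dbar}`. -/
theorem a1m2_cover_zero_mem : (X₀ ^ (d * p) * ηinv) ^ d₂ ∈ (weightedFiltration (![X₀, x₂] : Fin 2 → P) ![2, 1]).ideal (d₂ * (d * (2 * p))) := by
  have h0 : X₀ ^ (d * p) ∈ (weightedFiltration (![X₀, x₂] : Fin 2 → P) ![2, 1]).ideal (d * (2 * p)) := by
    have h := Ideal.pow_mem_pow (mem_weightedFiltration_ideal (![X₀, x₂] : Fin 2 → P) ![2, 1] 0) (d * p)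
    have hle := Veronese.idealFiltration_pow_le (weightedFiltration (![X₀, x₂] : Fin 2 → P) ![2, 1]) 2 (d * p)
    have e1 : 2 * (d * p) = d * (2 * p) := by ring
    rw [e1] at hle
    exact hle h
  have h1 : X₀ ^ (d * p) * ηinv ∈ (weightedFiltration (![X₀, x₂] : Fin 2 → P) ![2, 1]).ideal (d * (2 * p)) := Ideal.mul_mem_right _ _ h0
  have h := Ideal.pow_mem_pow h1 d₂
  have hle := Veronese.idealFiltration_pow_le (weightedFiltration (![X₀, x₂] : Fin 2 → P) ![2, 1]) (d * (2 * p)) d₂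
  have e1 : d * (2 * p) * d₂ = d₂ * (d * (2 * p)) := by ring
  rw [e1] at hle
  exact hle h

/-- **Cover element 1** of move 2: `y′₁ = N₂^{2dd₂} ∈ 𝒥′_{d₂·dbar}`. -/
theorem a1m2_cover_one_mem [NeZero p] :
    (∏ i : ZMod p, (x₂ + (i.val : P) * (s ^ 2 * X₀))) ^ (2 * d * d₂) ∈ (weightedFiltration (![X₀, x₂] : Fin 2 → P) ![2, 1]).ideal (d₂ * (d * (2 * p))) := by
  have h := Ideal.pow_mem_pow (a1m2_norm_mem s X₀ x₂ (p := p)) (2 * d * d₂)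
  have hle := Veronese.idealFiltration_pow_le (weightedFiltration (![X₀, x₂] : Fin 2 → P) ![2, 1]) p (2 * d * d₂)
  have e1 : p * (2 * d * d₂) = d₂ * (d * (2 * p)) := by ring
  rw [e1] at hle
  exact hle h

include hX₀ hηinv in
/-- `y′₀` is `τ`-fixed. -/
theorem a1m2_cover_zero_fixed : τ ((X₀ ^ (d * p) * ηinv) ^ d₂) = (X₀ ^ (d * p) * ηinv) ^ d₂ := by
  rw [map_pow, map_mul, map_pow, hX₀, hηinv]

include hs hX₀ hx₂ in
/-- `y′₁` is `τ`-fixed. -/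
theorem a1m2_cover_one_fixed [NeZero p] [CharP P p] (hp1 : p ≠ 1) :
    τ ((∏ i : ZMod p, (x₂ + (i.val : P) * (s ^ 2 * X₀))) ^ (2 * d * d₂)) = (∏ i : ZMod p, (x₂ + (i.val : P) * (s ^ 2 * X₀))) ^ (2 * d * d₂) := by
  rw [map_pow, a1m2_norm_fixed τ s X₀ x₂ hs hX₀ hx₂ hp1]

/-! ## `hrad` in `R^w(P; X₀, x₂)` -/

/-- `N₂·T^p = ∏ (Y₂ + i·s²·(X₀T²·T⁻¹))` in `P[T;T⁻¹]`. -/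
theorem a1m2_norm_T [NeZero p] : LaurentPolynomial.C (∏ i : ZMod p, (x₂ + (i.val : P) * (s ^ 2 * X₀))) * LaurentPolynomial.T (p : ℤ) =
    ∏ i : ZMod p, (LaurentPolynomial.C x₂ * LaurentPolynomial.T 1 +
      (i.val : P[T;T⁻¹]) * (LaurentPolynomial.C (s ^ 2) * (LaurentPolynomial.T (-1) * (LaurentPolynomial.C X₀ * LaurentPolynomial.T 2)))) := by
  have hfac : ∀ i : ZMod p, LaurentPolynomial.C x₂ * LaurentPolynomial.T 1 +
      (i.val : P[T;T⁻¹]) * (LaurentPolynomial.C (s ^ 2) * (LaurentPolynomial.T (-1) * (LaurentPolynomial.C X₀ * LaurentPolynomial.T 2))) =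
      LaurentPolynomial.C (x₂ + (i.val : P) * (s ^ 2 * X₀)) * LaurentPolynomial.T 1 := by
    intro i
    have hT : (LaurentPolynomial.T (-1) : P[T;T⁻¹]) * LaurentPolynomial.T 2 = LaurentPolynomial.T 1 := by
      rw [← LaurentPolynomial.T_add]; norm_num
    rw [map_add, map_mul, map_mul, map_natCast]
    calc LaurentPolynomial.C x₂ * LaurentPolynomial.T 1 +
          (i.val : P[T;T⁻¹]) * (LaurentPolynomial.C (s ^ 2) * (LaurentPolynomial.T (-1) * (LaurentPolynomial.C X₀ * LaurentPolynomial.T 2)))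
        = LaurentPolynomial.C x₂ * LaurentPolynomial.T 1 +
          (i.val : P[T;T⁻¹]) * LaurentPolynomial.C (s ^ 2) * LaurentPolynomial.C X₀ * (LaurentPolynomial.T (-1) * LaurentPolynomial.T 2) := by ring
      _ = _ := by rw [hT]; ring
  simp_rw [hfac]
  rw [Finset.prod_mul_distrib, ← map_prod, Finset.prod_const, Finset.card_univ, ZMod.card, LaurentPolynomial.T_pow, mul_one]

include hηη in
/-- ★ **`hrad` for move 2**: with the cover `y′₀ = (X₀^{dp}ηinv)^{d₂}`, `y′₁ = N₂^{2dd₂}` of degree `dbar₂ = d₂·d(2p)`, both generators `Y₀ = X₀T²`, `Y₂ = x₂T` of the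
irrelevant ideal of `R^w(P; X₀, x₂)` lie in `√(y′₀T^{dbar₂}, y′₁T^{dbar₂})`. [OURS · L1 W4.5c · a1 move 2] -/
theorem a1m2_hrad [NeZero p] (c₀ c₁ : ↥(cobordantAlgebra (![X₀, x₂] : Fin 2 → P) ![2, 1]))
    (hc₀ : (c₀ : P[T;T⁻¹]) = LaurentPolynomial.C ((X₀ ^ (d * p) * ηinv) ^ d₂) * LaurentPolynomial.T ((d₂ * (d * (2 * p)) : ℕ) : ℤ))
    (hc₁ : (c₁ : P[T;T⁻¹]) = LaurentPolynomial.C ((∏ i : ZMod p, (x₂ + (i.val : P) * (s ^ 2 * X₀))) ^ (2 * d * d₂)) *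
      LaurentPolynomial.T ((d₂ * (d * (2 * p)) : ℕ) : ℤ)) (i : Fin 2) :
    cobordantAlgebra.u' (![X₀, x₂] : Fin 2 → P) ![2, 1] i ∈ (Ideal.span ({c₀, c₁} : Set ↥(cobordantAlgebra (![X₀, x₂] : Fin 2 → P) ![2, 1]))).radical := by
  set Y₀ := cobordantAlgebra.u' (![X₀, x₂] : Fin 2 → P) ![2, 1] 0 with hY₀def
  set Y₂ := cobordantAlgebra.u' (![X₀, x₂] : Fin 2 → P) ![2, 1] 1 with hY₂def
  set s₂ := cobordantAlgebra.s (![X₀, x₂] : Fin 2 → P) ![2, 1] with hs₂def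
  -- `Y₀^{dp d₂} = c₀ · η^{d₂}`
  have hY0 : Y₀ ^ (d * p * d₂) = c₀ * algebraMap P _ (η ^ d₂) := by
    refine Subtype.ext ?_
    rw [SubmonoidClass.coe_pow, MulMemClass.coe_mul, hY₀def, cobordantAlgebra.coe_u', cobordantAlgebra.coe_algebraMap, hc₀]
    change (LaurentPolynomial.C X₀ * LaurentPolynomial.T ((2 : ℕ) : ℤ)) ^ (d * p * d₂) = _
    have hXη : (X₀ ^ (d * p) * ηinv) ^ d₂ * η ^ d₂ = X₀ ^ (d * p * d₂) := by
      rw [← mul_pow, mul_assoc, mul_comm ηinv, hηη, mul_one, ← pow_mul]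
    rw [mul_pow, ← map_pow, LaurentPolynomial.T_pow, mul_right_comm (LaurentPolynomial.C ((X₀ ^ (d * p) * ηinv) ^ d₂)), ← map_mul, hXη,
      show ((d * p * d₂ : ℕ) : ℤ) * ((2 : ℕ) : ℤ) = ((d₂ * (d * (2 * p)) : ℕ) : ℤ) by push_cast; ring]
  have hY0rad : Y₀ ∈ (Ideal.span ({c₀, c₁} : Set ↥(cobordantAlgebra (![X₀, x₂] : Fin 2 → P) ![2, 1]))).radical := by
    refine ⟨d * p * d₂, ?_⟩
    rw [hY0]
    exact Ideal.mul_mem_right _ _ (Ideal.subset_span (by simp))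
  fin_cases i
  · exact hY0rad
  · change Y₂ ∈ _
    have hprod : (∏ j : ZMod p, (Y₂ + algebraMap P _ ((j.val : P) * s ^ 2) * (s₂ * Y₀))) ^ (2 * d * d₂) = c₁ := by
      refine Subtype.ext ?_
      rw [SubmonoidClass.coe_pow, SubmonoidClass.coe_finsetProd, hc₁]
      have hj : ∀ j : ZMod p, ((Y₂ + algebraMap P _ ((j.val : P) * s ^ 2) * (s₂ * Y₀) : ↥(cobordantAlgebra (![X₀, x₂] : Fin 2 → P) ![2, 1])) : P[T;T⁻¹]) =
          LaurentPolynomial.C x₂ * LaurentPolynomial.T 1 +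
            (j.val : P[T;T⁻¹]) * (LaurentPolynomial.C (s ^ 2) * (LaurentPolynomial.T (-1) * (LaurentPolynomial.C X₀ * LaurentPolynomial.T 2))) := by
        intro j
        rw [AddMemClass.coe_add, MulMemClass.coe_mul, MulMemClass.coe_mul, hY₂def, hY₀def, hs₂def, cobordantAlgebra.coe_u', cobordantAlgebra.coe_u',
          cobordantAlgebra.coe_s, cobordantAlgebra.coe_algebraMap, map_mul, map_natCast]
        simp only [Matrix.cons_val_zero, Matrix.cons_val_one]
        push_cast
        ring
      simp_rw [hj]
      rw [← a1m2_norm_T s X₀ x₂ (p := p), mul_pow, ← map_pow, LaurentPolynomial.T_pow]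
      congr 2
      push_cast
      ring
    have hdiff : (∏ j : ZMod p, (Y₂ + algebraMap P _ ((j.val : P) * s ^ 2) * (s₂ * Y₀))) - Y₂ ^ p ∈ Ideal.span {s₂ * Y₀} :=
      prod_add_mul_sub_pow_mem Y₂ (s₂ * Y₀) fun j => algebraMap P _ ((j.val : P) * s ^ 2)
    have hrad1 : s₂ * Y₀ ∈ (Ideal.span ({c₀, c₁} : Set ↥(cobordantAlgebra (![X₀, x₂] : Fin 2 → P) ![2, 1]))).radical :=
      Ideal.mul_mem_left _ _ hY0rad
    have hP : (∏ j : ZMod p, (Y₂ + algebraMap P _ ((j.val : P) * s ^ 2) * (s₂ * Y₀))) ∈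
        (Ideal.span ({c₀, c₁} : Set ↥(cobordantAlgebra (![X₀, x₂] : Fin 2 → P) ![2, 1]))).radical := by
      refine ⟨2 * d * d₂, ?_⟩
      rw [hprod]
      exact Ideal.subset_span (by simp)
    have hYp : Y₂ ^ p ∈ (Ideal.span ({c₀, c₁} : Set ↥(cobordantAlgebra (![X₀, x₂] : Fin 2 → P) ![2, 1]))).radical := by
      have h2 : (∏ j : ZMod p, (Y₂ + algebraMap P _ ((j.val : P) * s ^ 2) * (s₂ * Y₀))) - Y₂ ^ p ∈
          (Ideal.span ({c₀, c₁} : Set ↥(cobordantAlgebra (![X₀, x₂] : Fin 2 → P) ![2, 1]))).radical :=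
        (Ideal.span_singleton_le_iff_mem _ |>.mpr hrad1) hdiff
      have := sub_mem hP h2
      rwa [sub_sub_cancel] at this
    exact Ideal.mem_radical_of_pow_mem hYp

/-! ## Degrees and the residual sections on the charts of the cover -/

section Sections

variable {m : ℕ} (r : Fin m → ℕ) (𝒜 : (Π j : Fin m, ZMod (r j)) → AddSubgroup P) [GradedRing 𝒜] (θ : Π j : Fin m, ZMod (r j))
  (hX₀d : X₀ ∈ 𝒜 (2 • θ)) (hx₂d : x₂ ∈ 𝒜 0) (hX₁d : X₁ ∈ 𝒜 θ) (hsd : s ∈ 𝒜 (-θ)) (hηinvd : ηinv ∈ 𝒜 (-((d * (2 * p)) • θ)))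

omit [GradedRing 𝒜] in
include hX₀d hx₂d in
/-- The centre `(X₀, x₂)` is homogeneous of degrees `(2•θ, 0)`. -/
theorem a1m2_hf (i : Fin 2) : (![X₀, x₂] : Fin 2 → P) i ∈ 𝒜 ((![2 • θ, 0] : Fin 2 → Π j : Fin m, ZMod (r j)) i) := by
  fin_cases i
  · exact hX₀d
  · exact hx₂d

include hX₀d hηinvd in
/-- `y′₀` has degree 0. -/
theorem a1m2_cover_zero_deg : (X₀ ^ (d * p) * ηinv) ^ d₂ ∈ 𝒜 0 := by
  have h1 : X₀ ^ (d * p) * ηinv ∈ 𝒜 ((d * p) • (2 • θ) + -((d * (2 * p)) • θ)) := SetLike.mul_mem_graded (SetLike.pow_mem_graded _ hX₀d) hηinvd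
  have e1 : (d * p) • (2 • θ) + -((d * (2 * p)) • θ) = 0 := by
    rw [← mul_nsmul', show d * p * 2 = d * (2 * p) by ring, add_neg_cancel]
  rw [e1] at h1
  have h := SetLike.pow_mem_graded d₂ h1
  rwa [smul_zero] at h

include hX₀d hx₂d hsd in
/-- `N₂` has degree 0. -/
theorem a1m2_norm_deg [NeZero p] : (∏ i : ZMod p, (x₂ + (i.val : P) * (s ^ 2 * X₀))) ∈ 𝒜 0 := by
  have hfac : ∀ i : ZMod p, x₂ + (i.val : P) * (s ^ 2 * X₀) ∈ 𝒜 0 := by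
    intro i
    refine add_mem hx₂d ?_
    have hsX : s ^ 2 * X₀ ∈ 𝒜 (2 • (-θ) + 2 • θ) := SetLike.mul_mem_graded (SetLike.pow_mem_graded 2 hsd) hX₀d
    rw [smul_neg, neg_add_cancel] at hsX
    have hn : ((i.val : P)) ∈ 𝒜 0 := SetLike.natCast_mem_graded _ _
    have := SetLike.mul_mem_graded hn hsX
    rwa [add_zero] at this
  have h := SetLike.prod_mem_graded (A := 𝒜) (i := fun _ => (0 : Π j : Fin m, ZMod (r j))) (g := fun i => x₂ + (i.val : P) * (s ^ 2 * X₀))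
    (F := Finset.univ) (fun i _ => hfac i)
  rwa [Finset.sum_const_zero] at h

include hX₀d hx₂d hηinvd in
/-- `v_b = ((Y₀ s₂)^{dbar} ηinv²)^{d₂}` has bidegree `(dbar₂, 0)`. -/
theorem a1m2_vb_mem_reesPiece :
    ((cobordantAlgebra.u' (![X₀, x₂] : Fin 2 → P) ![2, 1] 0 * cobordantAlgebra.s (![X₀, x₂] : Fin 2 → P) ![2, 1]) ^ (d * (2 * p)) *
        algebraMap P _ ηinv ^ 2) ^ d₂ ∈
      reesPiece 𝒜 (![X₀, x₂] : Fin 2 → P) ![2, 1] (((d₂ * (d * (2 * p)) : ℕ) : ℤ), (0 : Π j : Fin m, ZMod (r j))) := by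
  letI := reesGradedRing 𝒜 (![X₀, x₂] : Fin 2 → P) ![2, 1] (a1m2_hf X₀ x₂ r 𝒜 θ hX₀d hx₂d)
  have hY : cobordantAlgebra.u' (![X₀, x₂] : Fin 2 → P) ![2, 1] 0 ∈ reesPiece 𝒜 (![X₀, x₂] : Fin 2 → P) ![2, 1] ((2 : ℤ), 2 • θ) :=
    u'_mem_reesPiece 𝒜 (![X₀, x₂] : Fin 2 → P) (δ := ![2 • θ, 0]) ![2, 1] (a1m2_hf X₀ x₂ r 𝒜 θ hX₀d hx₂d) 0
  have hS := s_mem_reesPiece 𝒜 (![X₀, x₂] : Fin 2 → P) ![2, 1]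
  have hη := algebraMap_mem_reesPiece 𝒜 (![X₀, x₂] : Fin 2 → P) ![2, 1] hηinvd
  have h1 := SetLike.mul_mem_graded (SetLike.pow_mem_graded (d * (2 * p)) (SetLike.mul_mem_graded hY hS)) (SetLike.pow_mem_graded 2 hη)
  have h := SetLike.pow_mem_graded d₂ h1
  have e1 : d₂ • ((d * (2 * p)) • (((2 : ℤ), 2 • θ) + ((-1 : ℤ), (0 : Π j : Fin m, ZMod (r j)))) + 2 • ((0 : ℤ), -((d * (2 * p)) • θ))) =
      (((d₂ * (d * (2 * p)) : ℕ) : ℤ), (0 : Π j : Fin m, ZMod (r j))) := by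
    refine Prod.ext ?_ ?_
    · simp
    · simp only [Prod.snd_add, Prod.smul_snd, smul_add, smul_neg, smul_zero, add_zero]
      module
  rwa [e1] at h

include hX₀d hx₂d hX₁d hηinvd in
/-- `v_c = ((X₁ Y₂)^{dbar} ηinv)^{d₂}` has bidegree `(dbar₂, 0)`. -/
theorem a1m2_vc_mem_reesPiece :
    ((algebraMap P _ X₁ * cobordantAlgebra.u' (![X₀, x₂] : Fin 2 → P) ![2, 1] 1) ^ (d * (2 * p)) * algebraMap P _ ηinv) ^ d₂ ∈
      reesPiece 𝒜 (![X₀, x₂] : Fin 2 → P) ![2, 1] (((d₂ * (d * (2 * p)) : ℕ) : ℤ), (0 : Π j : Fin m, ZMod (r j))) := by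
  letI := reesGradedRing 𝒜 (![X₀, x₂] : Fin 2 → P) ![2, 1] (a1m2_hf X₀ x₂ r 𝒜 θ hX₀d hx₂d)
  have hY : cobordantAlgebra.u' (![X₀, x₂] : Fin 2 → P) ![2, 1] 1 ∈ reesPiece 𝒜 (![X₀, x₂] : Fin 2 → P) ![2, 1] ((1 : ℤ), 0) :=
    u'_mem_reesPiece 𝒜 (![X₀, x₂] : Fin 2 → P) (δ := ![2 • θ, 0]) ![2, 1] (a1m2_hf X₀ x₂ r 𝒜 θ hX₀d hx₂d) 1
  have hX := algebraMap_mem_reesPiece 𝒜 (![X₀, x₂] : Fin 2 → P) ![2, 1] hX₁d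
  have hη := algebraMap_mem_reesPiece 𝒜 (![X₀, x₂] : Fin 2 → P) ![2, 1] hηinvd
  have h1 := SetLike.mul_mem_graded (SetLike.pow_mem_graded (d * (2 * p)) (SetLike.mul_mem_graded hX hY)) hη
  have h := SetLike.pow_mem_graded d₂ h1
  have e1 : d₂ • ((d * (2 * p)) • (((0 : ℤ), θ) + ((1 : ℤ), (0 : Π j : Fin m, ZMod (r j)))) + ((0 : ℤ), -((d * (2 * p)) • θ))) =
      (((d₂ * (d * (2 * p)) : ℕ) : ℤ), (0 : Π j : Fin m, ZMod (r j))) := by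
    refine Prod.ext ?_ ?_
    · simp
    · simp
  rwa [e1] at h

variable {dbar₂ : ℕ} (y : ↥(𝒜 0)) (hy : y ∈ (traceFiltration 𝒜 (![X₀, x₂] : Fin 2 → P) ![2, 1]).ideal dbar₂)

include hX₀d hx₂d hηinvd in
/-- ★ **Residual section b** on the chart `y′` (`dbar₂ = d₂·d(2p)`): `v_b / (y′T^{dbar₂})` has degree 0 and lies in `𝔞·R_{y′}` for every ideal `𝔞 ∋ Y₀ s₂`. -/
theorem a1m2_residualSection_b (hdbar₂ : dbar₂ = d₂ * (d * (2 * p))) (𝔞 : Ideal ↥(cobordantAlgebra (![X₀, x₂] : Fin 2 → P) ![2, 1]))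
    (h𝔞 : cobordantAlgebra.u' (![X₀, x₂] : Fin 2 → P) ![2, 1] 0 * cobordantAlgebra.s (![X₀, x₂] : Fin 2 → P) ![2, 1] ∈ 𝔞) (hd₂ : 0 < d₂) (hdp : 0 < d * (2 * p)) :
    algebraMap _ (ChartRing 𝒜 (![X₀, x₂] : Fin 2 → P) ![2, 1] dbar₂ y hy)
          (((cobordantAlgebra.u' (![X₀, x₂] : Fin 2 → P) ![2, 1] 0 * cobordantAlgebra.s (![X₀, x₂] : Fin 2 → P) ![2, 1]) ^ (d * (2 * p)) *
            algebraMap P _ ηinv ^ 2) ^ d₂) *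
        IsLocalization.Away.invSelf (coverElement 𝒜 (![X₀, x₂] : Fin 2 → P) ![2, 1] dbar₂ y hy) ∈
        chartNodeGrading r 𝒜 (![X₀, x₂] : Fin 2 → P) ![2, 1] (a1m2_hf X₀ x₂ r 𝒜 θ hX₀d hx₂d) dbar₂ y hy 0 ∧
      algebraMap _ (ChartRing 𝒜 (![X₀, x₂] : Fin 2 → P) ![2, 1] dbar₂ y hy)
          (((cobordantAlgebra.u' (![X₀, x₂] : Fin 2 → P) ![2, 1] 0 * cobordantAlgebra.s (![X₀, x₂] : Fin 2 → P) ![2, 1]) ^ (d * (2 * p)) *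
            algebraMap P _ ηinv ^ 2) ^ d₂) *
        IsLocalization.Away.invSelf (coverElement 𝒜 (![X₀, x₂] : Fin 2 → P) ![2, 1] dbar₂ y hy) ∈
        𝔞.map (algebraMap _ (ChartRing 𝒜 (![X₀, x₂] : Fin 2 → P) ![2, 1] dbar₂ y hy)) := by
  subst hdbar₂
  refine ⟨residualSection_mem_chartNodeGrading_zero r 𝒜 _ _ _ y hy (a1m2_vb_mem_reesPiece X₀ x₂ ηinv d d₂ r 𝒜 θ hX₀d hx₂d hηinvd),
    residualSection_mem_map r 𝒜 _ _ y hy (Ideal.pow_mem_of_mem 𝔞 (Ideal.mul_mem_right _ _ (Ideal.pow_mem_of_mem 𝔞 h𝔞 _ hdp)) _ hd₂)⟩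

include hX₀d hx₂d hX₁d hηinvd in
/-- ★ **Residual section c** on the chart `y′`: `v_c / (y′T^{dbar₂})` has degree 0 and lies in `𝔞·R_{y′}` for every ideal `𝔞 ∋ X₁ Y₂`. -/
theorem a1m2_residualSection_c (hdbar₂ : dbar₂ = d₂ * (d * (2 * p))) (𝔞 : Ideal ↥(cobordantAlgebra (![X₀, x₂] : Fin 2 → P) ![2, 1]))
    (h𝔞 : algebraMap P _ X₁ * cobordantAlgebra.u' (![X₀, x₂] : Fin 2 → P) ![2, 1] 1 ∈ 𝔞) (hd₂ : 0 < d₂) (hdp : 0 < d * (2 * p)) :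
    algebraMap _ (ChartRing 𝒜 (![X₀, x₂] : Fin 2 → P) ![2, 1] dbar₂ y hy)
          (((algebraMap P _ X₁ * cobordantAlgebra.u' (![X₀, x₂] : Fin 2 → P) ![2, 1] 1) ^ (d * (2 * p)) * algebraMap P _ ηinv) ^ d₂) *
        IsLocalization.Away.invSelf (coverElement 𝒜 (![X₀, x₂] : Fin 2 → P) ![2, 1] dbar₂ y hy) ∈
        chartNodeGrading r 𝒜 (![X₀, x₂] : Fin 2 → P) ![2, 1] (a1m2_hf X₀ x₂ r 𝒜 θ hX₀d hx₂d) dbar₂ y hy 0 ∧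
      algebraMap _ (ChartRing 𝒜 (![X₀, x₂] : Fin 2 → P) ![2, 1] dbar₂ y hy)
          (((algebraMap P _ X₁ * cobordantAlgebra.u' (![X₀, x₂] : Fin 2 → P) ![2, 1] 1) ^ (d * (2 * p)) * algebraMap P _ ηinv) ^ d₂) *
        IsLocalization.Away.invSelf (coverElement 𝒜 (![X₀, x₂] : Fin 2 → P) ![2, 1] dbar₂ y hy) ∈
        𝔞.map (algebraMap _ (ChartRing 𝒜 (![X₀, x₂] : Fin 2 → P) ![2, 1] dbar₂ y hy)) := by
  subst hdbar₂
  refine ⟨residualSection_mem_chartNodeGrading_zero r 𝒜 _ _ _ y hy (a1m2_vc_mem_reesPiece X₀ X₁ x₂ ηinv d d₂ r 𝒜 θ hX₀d hx₂d hX₁d hηinvd),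
    residualSection_mem_map r 𝒜 _ _ y hy (Ideal.pow_mem_of_mem 𝔞 (Ideal.mul_mem_right _ _ (Ideal.pow_mem_of_mem 𝔞 h𝔞 _ hdp)) _ hd₂)⟩

end Sections

end Summit.ResolutionOfSingularities.ResolutionOfSingularities.Theorems.WildQuotientResolution.S1.KillCert.A1

end
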